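import Summits.Ventures.HSemireg.ContractionSpanKunnethBox
import Summits.Ventures.HSemireg.ContractionRankPointIdeal
import HarnessLib

/-!
# Venture HSemireg — `contractionRank` of a POINT-PAIR BOX class on the REAL carriers:
# `r(A, κ) = 6n² - 2n` (`dim A = 2n`, `n ≥ 3`) and `= 18` (`n = 2`) whenever `H¹`, `H^{0,1}` and the total class split as on
# `X × X′` with `κ = ch(I_p ⊠ I_q)`

HONEST FRAMING. The end-to-end form of th-7's K_lin at degree `2` (`theory/FORMULA-N-th7.md` §N.3 / §N.5, structure column
«`6n² - 2n`») on the carriers of `PerfectComplexRankDoor.lean` (seat p4 of the computation cell `pub-hsemireg`): the box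
theorems of `ContractionSpanKunnethBox.lean` instantiated at `V = H¹(A(ℂ); ℂ)`, `L = H^{0,1}` (the tree's `hodgeZeroOne`,
carrier `hodgeZeroOneSet A`), `Θ = vectorFieldSet A = L^⊥`. The SPLITTING is an INPUT, stated by value exactly as the
`a·1 + b·ω` hypothesis of `ContractionRankPointIdeal.lean` (th-7 §N.5 dictionary): complementary `2n`-dimensional subspaces
`V₁, V₂` of `H¹(A)` («`H¹(X) ⊕ H¹(X′)`», Künneth), `n`-dimensional `Lᵢ ⊆ Vᵢ` with `H^{0,1}(A) = L₁ ⊕ L₂`, top forms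
`ωᵢ ≠ 0` of `Vᵢ`, and `totalExteriorClass A κ = (a₁ + b₁ω₁) ∧ (a₂ + b₂ω₂)` («`ch(I_p ⊠ I_q) = pr₁^* ch(I_p) ∧ pr₂^* ch(I_q)`»
read in `Λ H¹`; `hA` is any smooth-projective presentation, e.g. `AbelianVariety.isSmoothProjective_holds`) — the tree has no product-of-abelian-varieties Künneth theorem, so nothing here DERIVES this shape for an
explicit `X × X′`; a consumer supplies it. Nothing here is a claim about any explicit variety; nothing here says that
HC / HC_CM / HC_AV holds. Everything PROVED; no named fact.
-/

noncomputable section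

open CliffordAlgebra (contractLeft)
open Module
open Literature.AlgebraicGeometry.Motives Literature.AlgebraicGeometry.HodgeTheory

namespace Summit.Ventures.HSemireg

variable (A : AbelianVariety ℂ)

/-- On the real carriers the contraction span is finite-dimensional, so `contractionRank` is a `finrank`.
[cite: BuchweitzFlenner2008HH, Prop. 6.4.4] -/
theorem contractionRank_eq_finrank_span (κ : ∀ p : ℕ, complexBetti A.X (2 * p)) :
    contractionRank A κ = (Module.finrank ℂ
      (ContractionSpan.span (hodgeZeroOneSet A) (vectorFieldSet A) (totalExteriorClass A κ)) : Cardinal) := by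
  haveI : Module.Finite ℂ (complexBetti A.X 1) := abelianVarietyCohomologyExteriorH1_holds.finite_one A
  haveI : FiniteDimensional ℂ (ExteriorAlgebra ℂ (complexBetti A.X 1)) := ContractionSpan.finiteDimensional_exteriorAlgebra
  rw [contractionRank_eq_rank_span, Module.finrank_eq_rank]

variable {A} {V₁ V₂ L₁ L₂ : Submodule ℂ (complexBetti A.X 1)}

/-- **`r(A, κ) = 6n² - 2n` for a point-pair box class on an abelian variety of dimension `2n`, `n ≥ 3`** (e.g. `48` on a
sixfold that is a product of two threefolds): if `H¹(A) = V₁ ⊕ V₂` with `dim Vᵢ = 2n`, `H^{0,1}(A) = L₁ ⊕ L₂` with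
`Lᵢ ⊆ Vᵢ` of dimension `n`, and the total class of `κ` in `Λ H¹(A)` is `(a₁ + b₁ω₁) ∧ (a₂ + b₂ω₂)` for top forms `ωᵢ ≠ 0`
of `Vᵢ` and `aᵢ, bᵢ ≠ 0`, then `contractionRank A κ = 6n² - 2n`.
[cite: BuchweitzFlenner2008HH, Prop. 6.4.4] [cite: MumfordAV1970, §1 (4) and §4 (iii)] -/
theorem contractionRank_pointPairBox (hA : IsSmoothProjective A.dim A.X) (κ : ∀ p : ℕ, complexBetti A.X (2 * p)) {n : ℕ}
    (hn : 3 ≤ n) (hV : IsCompl V₁ V₂) (hV₁ : Module.finrank ℂ V₁ = 2 * n) (hV₂ : Module.finrank ℂ V₂ = 2 * n)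
    (hL : hodgeZeroOne hA = L₁ ⊔ L₂) (hL₁ : L₁ ≤ V₁) (hL₂ : L₂ ≤ V₂)
    (hl₁ : Module.finrank ℂ L₁ = n) (hl₂ : Module.finrank ℂ L₂ = n)
    {ω₁ : ExteriorAlgebra ℂ V₁} (hω₁ : ω₁ ∈ ⋀[ℂ]^(2 * n) V₁) (hω₁0 : ω₁ ≠ 0)
    {ω₂ : ExteriorAlgebra ℂ V₂} (hω₂ : ω₂ ∈ ⋀[ℂ]^(2 * n) V₂) (hω₂0 : ω₂ ≠ 0)
    {a₁ b₁ a₂ b₂ : ℂ} (ha₁ : a₁ ≠ 0) (hb₁ : b₁ ≠ 0) (ha₂ : a₂ ≠ 0) (hb₂ : b₂ ≠ 0)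
    (hx : totalExteriorClass A κ =
      ExteriorAlgebra.map V₁.subtype (algebraMap ℂ _ a₁ + b₁ • ω₁) * ExteriorAlgebra.map V₂.subtype (algebraMap ℂ _ a₂ + b₂ • ω₂)) :
    contractionRank A κ = ((6 * n ^ 2 - 2 * n : ℕ) : Cardinal) := by
  haveI : Module.Finite ℂ (complexBetti A.X 1) := abelianVarietyCohomologyExteriorH1_holds.finite_one A
  rw [contractionRank_eq_finrank_span, hx, vectorFieldSet_eq A hA rfl, ← coe_hodgeZeroOne_eq_hodgeZeroOneSet A hA rfl]
  rw [hL]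
  rw [ContractionSpan.finrank_span_pointPairBox' hV hn hV₁ hV₂ hL₁ hL₂ hl₁ hl₂ hω₁ hω₁0 hω₂ hω₂0 ha₁ hb₁ ha₂ hb₂]

/-- **`r(A, κ) = 18` for a point-pair box class on an abelian FOURFOLD** (`n = 2`: `A = X × X̂`-shape, `X` an abelian
surface — the census' `r = 18` at `g = 4` as a theorem of the class shape). Hypotheses as above with `dim Vᵢ = 4`,
`dim Lᵢ = 2`. [cite: BuchweitzFlenner2008HH, Prop. 6.4.4] [cite: MumfordAV1970, §1 (4) and §4 (iii)] -/
theorem contractionRank_pointPairBox_two (hA : IsSmoothProjective A.dim A.X) (κ : ∀ p : ℕ, complexBetti A.X (2 * p))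
    (hV : IsCompl V₁ V₂) (hV₁ : Module.finrank ℂ V₁ = 4) (hV₂ : Module.finrank ℂ V₂ = 4)
    (hL : hodgeZeroOne hA = L₁ ⊔ L₂) (hL₁ : L₁ ≤ V₁) (hL₂ : L₂ ≤ V₂)
    (hl₁ : Module.finrank ℂ L₁ = 2) (hl₂ : Module.finrank ℂ L₂ = 2)
    {ω₁ : ExteriorAlgebra ℂ V₁} (hω₁ : ω₁ ∈ ⋀[ℂ]^4 V₁) (hω₁0 : ω₁ ≠ 0)
    {ω₂ : ExteriorAlgebra ℂ V₂} (hω₂ : ω₂ ∈ ⋀[ℂ]^4 V₂) (hω₂0 : ω₂ ≠ 0)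
    {a₁ b₁ a₂ b₂ : ℂ} (ha₁ : a₁ ≠ 0) (hb₁ : b₁ ≠ 0) (ha₂ : a₂ ≠ 0) (hb₂ : b₂ ≠ 0)
    (hx : totalExteriorClass A κ =
      ExteriorAlgebra.map V₁.subtype (algebraMap ℂ _ a₁ + b₁ • ω₁) * ExteriorAlgebra.map V₂.subtype (algebraMap ℂ _ a₂ + b₂ • ω₂)) :
    contractionRank A κ = 18 := by
  haveI : Module.Finite ℂ (complexBetti A.X 1) := abelianVarietyCohomologyExteriorH1_holds.finite_one A
  rw [contractionRank_eq_finrank_span, hx, vectorFieldSet_eq A hA rfl, ← coe_hodgeZeroOne_eq_hodgeZeroOneSet A hA rfl]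
  rw [hL]
  rw [ContractionSpan.finrank_span_pointPairBox_two hV hV₁ hV₂ hL₁ hL₂ hl₁ hl₂ hω₁ hω₁0 hω₂ hω₂0 ha₁ hb₁ ha₂ hb₂,
    Nat.cast_ofNat]

end Summit.Ventures.HSemireg

end
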